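/-
Literature anchor (engines group, cap lane, anchor #38): CHAINS of mean-value-form `C¹` steps —
Moore's continuation (1979 §8.1 eq. (8.13)) from interval initial conditions in which every step
hands over the MEAN VALUE EXTENSION `φ(h, m) + J1·(W − m)` of the flow map
(`MeanValueEnclosureCertificate.lean`, Moore 1979 §4.3 (4.19); Mrozek–Zgliczyński 2000 Lemma 7.6
"improved bounds via interval sets") instead of the direct Taylor box: the whole transcript is one
kernel-decidable `Bool` with a soundness theorem (existence on the horizon, every-solution
enclosures at the mesh points).  Moore's Volterra example, four steps of `1/8` from `(1, 3)`:
`x(1/2)` is certified in a box of widths `0.0059 × 0.0109`, against `0.24 × 0.094` for the direct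
chain of `HighOrderChainCertificate.lean` — the wrapping effect of §8.2 tamed without a change of
coordinates.
-/
import Literature.Analysis.ODE.MeanValueEnclosureCertificate
import Literature.Analysis.ODE.HighOrderChainCertificate
import HarnessLib

/-!
# Kernel-checkable chains of mean-value-form enclosure steps

Topic `Literature/Analysis/ODE`.  R. E. Moore, *Methods and Applications of Interval Analysis*
(SIAM 1979): §8.1 eq. (8.13) continues a validated solution of `y' = P(y)` "from the new,
*interval* initial conditions", and §8.2 warns that handing over interval boxes step after step
suffers from the wrapping effect; §4.3 eq. (4.19) is the mean value extension
`f(X) ⊆ f(m) + ∑ᵢ DᵢF(X)(Xᵢ − mᵢ)`.  Mrozek–Zgliczyński 2000 §7.5 ("Improved bounds via interval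
sets", Lemma 7.6: `f(x + r) ⊂ x₁ + J g·r + w + x₁'`) is exactly the propagation of an interval set
by the mean value form, and §8 (first paragraph, p. 249) explains that iterating it is where the
wrapping effect lives, Lohner's parallelepipeds (§8.2) being the remedy.  This file makes the
transcript of the ITERATED MEAN VALUE FORM — for a polynomial field with rational data — a single
`Bool` decided by the kernel, with a soundness theorem, exactly as
`HighOrderChainCertificate.lean` did for the direct method:

* `MVStage n` = the data of one step (order, step, box `Wⱼ`, a-priori boxes `Sⱼ`, `VVⱼ`, centre
  `mⱼ`, the point certificate's order and a-priori box); `MVChainCert n` = field, stages, final box;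
  `MVChainCert.toHOEChain` forgets the mean value data: the mesh `τⱼ` and its bookkeeping
  (`HOEChainCert.mesh`, `meshQ`, `mesh_step`, `cast_meshQ`, …) are those of the underlying direct
  transcript and are reused, not restated;
* `MVChainCert.check` runs, for every stage, the mean value step check `MVStepCert.check` of
  `MeanValueEnclosureCertificate.lean` AND the landing test `bestEndBoxⱼ ⊆ W_{j+1}` (`boxLE`),
  `bestEndBox = (endBox(mⱼ) + J1ⱼ·(Wⱼ − mⱼ)) ∩ endBox(Wⱼ)`, with `W_N` the final box;
* `MVChainCert.sound`: if `check = true` then from every real `y₀ ∈ W₀` a solution exists on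
  `[0, τ_N]`, and EVERY solution from `y₀` has `y(τⱼ) ∈ Wⱼ` (`j ≤ N`),
  `y(τⱼ₊₁) ∈ bestEndBoxⱼ` and `y(t) ∈ Sⱼ` on `[τⱼ, τⱼ₊₁]` — the abstract chain theorems of
  `StepChain.lean` fed with `MVStepCert.exists_of_check` / `sound` / `mem_bestEndBox` per step;
  `MVChainCert.mem_final`: `y(τ_N) ∈ W_N`;
* `mvChainVerifier n : Verifier (HOEChainInstance n) HOEChainInstance.Claim` — a SECOND
  certificate format (lists of `MVStage`s) for the SAME instances and claims as
  `hoeChainVerifier` (field, initial box, horizon, final box ↦ existence and `y(T) ∈ F`).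

WORKED EXAMPLE (kernel): Moore's Volterra problem (8.6) from `x(0) = (1, 3)`, four steps of
`h = 1/8` at order `6`, centres = midpoints, hand-over boxes = `bestEndBox` rounded outward to
`10⁻⁷` (untrusted search): `mooreVolterraMVChain_check` (by `decide`),
`mooreVolterraMVChain_final` (`x(1/2) ∈ [0.1780709, 0.1839666] × [2.275256, 2.2861761]`, widths
`0.0059`, `0.0109`; existence on `[0, 1/2]` is already `mooreVolterraChain_exists`),
`mooreVolterraMVChain_final_le_direct` (this box lies inside the final box
`[0.0589367, 0.3025851] × [2.23366, 2.327983]` of the direct chain `mooreVolterraChain`, widths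
`0.24`, `0.094`, kernel-checked `boxLE`), `mooreVolterraMVChain_claim` (the verifier's claim:
existence and final enclosure).
Per step the direct boxes from `Wⱼ` have widths `(0.010, 0.0044)`, `(0.032, 0.013)`,
`(0.027, 0.015)`, `(0.019, 0.016)` while the mean value boxes have `(0.010, 0.0044)`,
`(0.0094, 0.0080)`, `(0.0075, 0.0100)`, `(0.0059, 0.0109)`: the first component even contracts
along the chain, as the flow does.  Honest limits: interval sets still wrap (MZ2000 §8) — for a
rotating flow the widths would grow, and the remedy (parallelepipeds / QR, §8.2–8.3) is NOT
formalised here; exact rationals, no rounding model; single precision of the data is whatever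
the untrusted stage chose.  No facts, no axioms beyond the standard three, no `sorry`.

## References

* R. E. Moore, *Methods and Applications of Interval Analysis*, SIAM 1979, §4.3 eq. (4.19),
  §8.1 eqs. (8.6), (8.13), §8.2 (wrapping effect).
  [held: lit key book:moorend-methods-applications-interval-analysis]
* M. Mrozek, P. Zgliczyński, *Set arithmetic and the enclosing problem in dynamics*, Ann. Polon.
  Math. 74 (2000) 237–259, Theorem 7.5, §7.5 Lemma 7.6, §8 (p. 249).
  [held: lit key paper:doi-10-4064-ap-74-1-237-259]
* P. Zgliczyński, *C¹-Lohner algorithm*, Found. Comput. Math. 2 (2002) 429–465, §3.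
* N. S. Nedialkov, K. R. Jackson, G. F. Corliss, *Validated solutions of initial value problems
  for ordinary differential equations*, Appl. Math. Comput. 105 (1999) 21–68, §5 Algorithm I.
* I. Walawska, D. Wilczak, *An implicit algorithm for validated enclosures of the solutions to
  variational equations for ODEs*, Appl. Math. Comput. 291 (2016), §2. [held: arXiv:1509.07388]
* R. E. Moore, *Interval Analysis*, Prentice-Hall 1966, §4.4.
-/

open Set NonemptyInterval
open Literature.Analysis.ValidatedNumerics

namespace Literature.Analysis.ODE

/-! ### Stages and the chain checker -/

section Chain

variable {n : ℕ}

/-- One **stage** of a mean-value-form step chain: order `Kⱼ`, step `hⱼ`, the box `Wⱼ` of values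
at `τⱼ`, the a-priori boxes `Sⱼ ⊇ y([τⱼ, τⱼ₊₁])` and `VVⱼ ⊇ V([0, hⱼ])`, the rational centre
`mⱼ ∈ Wⱼ`, and the order and a-priori box of the point certificate from `mⱼ` (the per-step data
of a `C¹`-Lohner-type step evaluated in mean value form).
[cite: Moore1979, §4.3 eq. (4.19)] [cite: Moore1979, §8.1 eq. (8.13)]
[cite: MrozekZgliczynski2000, §7.5 Lemma 7.6] -/
structure MVStage (n : ℕ) where
  /-- The order `Kⱼ ≥ 1` of the step. -/
  order : ℕ
  /-- The step size `hⱼ ≥ 0`. -/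
  step : ℚ
  /-- The box `Wⱼ` of admissible values at the left mesh point. -/
  init : Fin n → NonemptyInterval ℚ
  /-- The claimed a-priori enclosure `Sⱼ` of the states over the step. -/
  apriori : Fin n → NonemptyInterval ℚ
  /-- The claimed a-priori enclosure `VVⱼ` of the fundamental matrix over the step. -/
  jacApriori : Fin n → Fin n → NonemptyInterval ℚ
  /-- The rational centre `mⱼ ∈ Wⱼ`. -/
  center : Fin n → ℚ
  /-- The order of the point certificate from the centre. -/
  centerOrder : ℕ
  /-- The a-priori enclosure of the solution from the centre over the step. -/
  centerApriori : Fin n → NonemptyInterval ℚ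

/-- The mean value step certificate of a stage for the field `P`.
[cite: Moore1979, §4.3 eq. (4.19)] [cite: MrozekZgliczynski2000, §7.5 Lemma 7.6] -/
def MVStage.toCert (P : Fin n → QMvPoly) (s : MVStage n) : MVStepCert n where
  field := P
  order := s.order
  step := s.step
  init := s.init
  apriori := s.apriori
  jacApriori := s.jacApriori
  center := s.center
  centerOrder := s.centerOrder
  centerApriori := s.centerApriori

/-- Forgetting the mean value data of a stage gives a stage of the direct method (same order,
step, box `Wⱼ` and a-priori box `Sⱼ`; `HighOrderChainCertificate.lean`).
[cite: Moore1979, §8.1 eq. (8.13)] [cite: NedialkovJacksonCorliss1999, §5 Algorithm I] -/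
def MVStage.toHOEStage (s : MVStage n) : HOEStage n :=
  ⟨s.order, s.step, s.init, s.apriori⟩

/-- The padding stage built on a box `fin` (order `0`, step `0`, all boxes `fin`, zero matrix box
and centre), used beyond the last step so that `W_N` is the final box.
[cite: NedialkovJacksonCorliss1999, §5 Algorithm I] -/
def MVStage.padOf (fin : Fin n → NonemptyInterval ℚ) : MVStage n :=
  ⟨0, 0, fin, fin, fun _ _ => pure 0, fun _ => 0, 0, fin⟩

/-- The box the end enclosure of the current stage must land in: the initial box of the next
stage, or the final box after the last stage. [cite: NedialkovJacksonCorliss1999, §5 Algorithm I] -/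
def mvNextInit (fin : Fin n → NonemptyInterval ℚ) : List (MVStage n) → Fin n → NonemptyInterval ℚ
  | [] => fin
  | s :: _ => s.init

/-- **The chain checker** on a list of mean value stages: every stage passes the mean value step
check and its `bestEndBox = mvEndBox ∩ endBox` lands in the next initial box (in the final box
for the last stage). [cite: Moore1979, §8.1 eq. (8.13)] [cite: Moore1979, §4.3 eq. (4.19)]
[cite: MrozekZgliczynski2000, §7.5 Lemma 7.6] -/
def mvChainCheck (P : Fin n → QMvPoly) (fin : Fin n → NonemptyInterval ℚ) : List (MVStage n) → Bool
  | [] => true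
  | s :: rest =>
      (s.toCert P).check && boxLE (s.toCert P).bestEndBox (mvNextInit fin rest) &&
        mvChainCheck P fin rest

/-- A **mean-value-form step-chain certificate** for a polynomial initial value problem with
rational data: the field, the stages, and the claimed enclosure `W_N` of the values at the end
of the mesh. [cite: Moore1979, §8.1 eq. (8.13)] [cite: MrozekZgliczynski2000, §7.5 Lemma 7.6] -/
structure MVChainCert (n : ℕ) where
  /-- The polynomial vector field, one term list per component. -/
  field : Fin n → QMvPoly
  /-- The stages, in temporal order. -/
  stages : List (MVStage n)
  /-- The claimed final box `W_N ∋ y(τ_N)`. -/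
  final : Fin n → NonemptyInterval ℚ

namespace MVChainCert

variable (c : MVChainCert n)

/-- Number of steps `N`. [cite: NedialkovJacksonCorliss1999, §5 Algorithm I] -/
def size : ℕ := c.stages.length

/-- The padding stage (all boxes the final box). [cite: NedialkovJacksonCorliss1999, §5 Algorithm I] -/
def padStage : MVStage n := MVStage.padOf c.final

/-- Stage `j` (the padding stage for `j ≥ N`). [cite: NedialkovJacksonCorliss1999, §5 Algorithm I] -/
def stageAt (j : ℕ) : MVStage n := c.stages.getD j c.padStage

/-- The mean value step certificate of stage `j`. [cite: Moore1979, §4.3 eq. (4.19)]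
[cite: MrozekZgliczynski2000, §7.5 Lemma 7.6] -/
def certAt (j : ℕ) : MVStepCert n := (c.stageAt j).toCert c.field

/-- The box `Wⱼ` at mesh point `j` (`W_N` = the final box). [cite: Moore1979, §8.1 eq. (8.13)] -/
def initAt (j : ℕ) : Fin n → NonemptyInterval ℚ := (c.stageAt j).init

/-- **The underlying direct transcript** (`HighOrderChainCertificate.lean`): same field, orders,
steps, boxes `Wⱼ`, `Sⱼ` and final box, the mean value data forgotten.  Its mesh `τⱼ`
(`HOEChainCert.mesh` / `meshQ`) and bookkeeping are REUSED for the mean value chain; its own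
`check` is not (the direct end boxes need not land in the narrow hand-over boxes).
[cite: Moore1979, §8.1 eq. (8.13)] [cite: NedialkovJacksonCorliss1999, §5 Algorithm I] -/
def toHOEChain : HOEChainCert n := ⟨c.field, c.stages.map MVStage.toHOEStage, c.final⟩

/-- **The checker** of a mean-value-form step-chain certificate. [cite: Moore1979, §8.1 eq. (8.13)]
[cite: Moore1979, §4.3 eq. (4.19)] [cite: MrozekZgliczynski2000, §7.5 Lemma 7.6] -/
def check : Bool := mvChainCheck c.field c.final c.stages

variable {c}

/-- The underlying direct transcript has the same number of steps. [cite: Moore1979, §8.1 eq. (8.13)] -/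
theorem toHOEChain_size : c.toHOEChain.size = c.size := by
  simp [toHOEChain, size, HOEChainCert.size]

/-- Stage `j` of the underlying direct transcript is stage `j` with the mean value data forgotten.
[cite: Moore1979, §8.1 eq. (8.13)] -/
theorem toHOEChain_stageAt (j : ℕ) : c.toHOEChain.stageAt j = (c.stageAt j).toHOEStage := by
  show (c.stages.map MVStage.toHOEStage).getD j (MVStage.toHOEStage c.padStage) = _
  rw [List.getD_map]
  rfl

/-- Same steps `hⱼ`. [cite: Moore1979, §8.1 eq. (8.13)] -/
theorem toHOEChain_step (j : ℕ) : (c.toHOEChain.stageAt j).step = (c.stageAt j).step := by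
  rw [toHOEChain_stageAt]; rfl

/-- Same boxes `Wⱼ`. [cite: Moore1979, §8.1 eq. (8.13)] -/
theorem toHOEChain_initAt (j : ℕ) : c.toHOEChain.initAt j = c.initAt j := by
  rw [HOEChainCert.initAt, toHOEChain_stageAt]; rfl

/-- The length of step `j` of the shared mesh is `hⱼ`. [cite: Moore1979, §8.1 eq. (8.13)] -/
theorem toHOEChain_mesh_step (j : ℕ) :
    c.toHOEChain.mesh (j + 1) - c.toHOEChain.mesh j = ((c.stageAt j).step : ℝ) := by
  rw [HOEChainCert.mesh_step, toHOEChain_step]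

/-- Stage `N` is the padding stage (`List.getD` past the end). [folklore] -/
private theorem stageAt_size : c.stageAt c.size = c.padStage := by
  simp [stageAt, size]

/-- What the chain checker establishes, stage by stage. [cite: NedialkovJacksonCorliss1999, §5 Algorithm I]
[cite: MrozekZgliczynski2000, §7.5 Lemma 7.6] -/
theorem mvChainCheck_spec {P : Fin n → QMvPoly} {fin : Fin n → NonemptyInterval ℚ} :
    ∀ (l : List (MVStage n)), mvChainCheck P fin l = true → ∀ j < l.length,
      ((l.getD j (MVStage.padOf fin)).toCert P).check = true ∧
        boxLE ((l.getD j (MVStage.padOf fin)).toCert P).bestEndBox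
          (l.getD (j + 1) (MVStage.padOf fin)).init = true
  | [], _, j, hj => absurd hj (Nat.not_lt_zero j)
  | s :: rest, h, j, hj => by
      simp only [mvChainCheck, Bool.and_eq_true] at h
      obtain ⟨⟨h1, h2⟩, h3⟩ := h
      cases j with
      | zero =>
          refine ⟨by simpa using h1, ?_⟩
          cases rest with
          | nil => simpa [mvNextInit, MVStage.padOf] using h2
          | cons s' rest' => simpa [mvNextInit] using h2
      | succ j =>
          simp only [List.getD_cons_succ]
          exact mvChainCheck_spec rest h3 j (by simpa using hj)

/-- Stage `j < N` of an accepted chain: its mean value step certificate is accepted and its best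
end box lands in `W_{j+1}`. [cite: NedialkovJacksonCorliss1999, §5 Algorithm I]
[cite: MrozekZgliczynski2000, §7.5 Lemma 7.6] -/
theorem check_stage (hc : c.check = true) {j : ℕ} (hj : j < c.size) :
    (c.certAt j).check = true ∧ boxLE (c.certAt j).bestEndBox (c.initAt (j + 1)) = true :=
  mvChainCheck_spec c.stages hc j hj

/-- The shared mesh of an accepted mean value chain is nondecreasing.
[cite: Moore1979, §8.1 eq. (8.13)] -/
theorem mesh_le_succ (hc : c.check = true) {j : ℕ} (hj : j < c.size) :
    c.toHOEChain.mesh j ≤ c.toHOEChain.mesh (j + 1) := by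
  rw [HOEChainCert.mesh_succ, toHOEChain_step]
  exact le_add_of_nonneg_right
    (VarStepCert.check_spec (MVStepCert.check_var (check_stage hc hj).1)).2.1

/-- **The landing step**: every solution from `x ∈ Wⱼ` over step `j` ends in `W_{j+1}`
(`∈ bestEndBoxⱼ ⊆ W_{j+1}`). [cite: Moore1979, §8.1 eq. (8.13)] [cite: Moore1979, §4.3 eq. (4.19)]
[cite: MrozekZgliczynski2000, §7.5 Lemma 7.6] -/
theorem landing (hc : c.check = true) {j : ℕ} (hj : j < c.size) {x : Fin n → ℝ}
    (hx : x ∈ boxSet (castBox (c.initAt j))) {z : ℝ → Fin n → ℝ} (hz0 : z 0 = x)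
    (hz : ∀ t ∈ Icc 0 ((c.stageAt j).step : ℝ),
      HasDerivWithinAt z (evalVec (fieldMv c.field) (z t)) (Icc 0 ((c.stageAt j).step : ℝ)) t) :
    z (c.stageAt j).step ∈ boxSet (castBox (c.initAt (j + 1))) := by
  obtain ⟨hcj, hland⟩ := check_stage hc hj
  exact boxSet_mono (castBox_mono (le_of_boxLE hland)) (MVStepCert.mem_bestEndBox hcj hx hz0 hz)

/-- **Soundness of the mean-value-form step-chain certificate** (Moore 1979 §8.1 (8.13):
continuation from interval initial conditions, each hand-over evaluated in the mean value form
(4.19); MZ2000 Lemma 7.6 iterated along the mesh `τⱼ` of the underlying transcript). If `check`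
accepts, then from every `y₀ ∈ W₀` a solution of `y' = P(y)` exists on `[0, τ_N]`, and EVERY
solution `y` from `y₀` on `[0, τ_N]` satisfies `y(τⱼ) ∈ Wⱼ` for `j ≤ N`,
`y(τⱼ₊₁) ∈ bestEndBoxⱼ = (endBox(mⱼ) + J1ⱼ·(Wⱼ − mⱼ)) ∩ endBox(Wⱼ)` and `y(t) ∈ Sⱼ` on
`[τⱼ, τⱼ₊₁]` for `j < N`. [cite: Moore1979, §8.1 eq. (8.13)] [cite: Moore1979, §4.3 eq. (4.19)]
[cite: MrozekZgliczynski2000, §7.5 Lemma 7.6] [cite: NedialkovJacksonCorliss1999, §5 Algorithm I] -/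
theorem sound (hc : c.check = true) {y₀ : Fin n → ℝ} (hy₀ : y₀ ∈ boxSet (castBox (c.initAt 0))) :
    (∃ y : ℝ → Fin n → ℝ, y 0 = y₀ ∧
        ∀ t ∈ Icc 0 (c.toHOEChain.mesh c.size),
          HasDerivWithinAt y (evalVec (fieldMv c.field) (y t))
            (Icc 0 (c.toHOEChain.mesh c.size)) t) ∧
      ∀ y : ℝ → Fin n → ℝ, y 0 = y₀ →
        (∀ t ∈ Icc 0 (c.toHOEChain.mesh c.size),
            HasDerivWithinAt y (evalVec (fieldMv c.field) (y t))
              (Icc 0 (c.toHOEChain.mesh c.size)) t) →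
          (∀ j ≤ c.size, y (c.toHOEChain.mesh j) ∈ boxSet (castBox (c.initAt j))) ∧
            (∀ j < c.size,
                y (c.toHOEChain.mesh (j + 1)) ∈ boxSet (castBox (c.certAt j).bestEndBox)) ∧
              ∀ j < c.size, ∀ t ∈ Icc (c.toHOEChain.mesh j) (c.toHOEChain.mesh (j + 1)),
                y t ∈ boxSet (castBox (c.stageAt j).apriori) := by
  -- the per-step enclosure relation of the abstract chain theorems
  set Q : ℕ → ℝ → (Fin n → ℝ) → (Fin n → ℝ) → Prop := fun j s _ w =>
    w ∈ boxSet (castBox (c.stageAt j).apriori) ∧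
      (s = ((c.stageAt j).step : ℝ) → w ∈ boxSet (castBox (c.certAt j).bestEndBox))
  set τ : ℕ → ℝ := c.toHOEChain.mesh
  have hτ0 : τ 0 = 0 := HOEChainCert.mesh_zero
  have hτs : ∀ j, τ (j + 1) - τ j = ((c.stageAt j).step : ℝ) := toHOEChain_mesh_step
  have hτ : ∀ j < c.size, τ j ≤ τ (j + 1) := fun j hj => mesh_le_succ hc hj
  have hall : ∀ j < c.size, ∀ x ∈ boxSet (castBox (c.initAt j)), ∀ z : ℝ → Fin n → ℝ, z 0 = x →
      (∀ s ∈ Icc 0 (τ (j + 1) - τ j),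
        HasDerivWithinAt z (evalVec (fieldMv c.field) (z s)) (Icc 0 (τ (j + 1) - τ j)) s) →
      ∀ s ∈ Icc 0 (τ (j + 1) - τ j), Q j s x (z s) := by
    intro j hj x hx z hz0 hz s hs
    rw [hτs] at hz hs
    have hcj := (check_stage hc hj).1
    show z s ∈ boxSet (castBox (c.stageAt j).apriori) ∧
      (s = ((c.stageAt j).step : ℝ) → z s ∈ boxSet (castBox (c.certAt j).bestEndBox))
    refine ⟨((HOEStepCert.sound (MVStepCert.check_toHOE hcj) hx).2 z hz0 hz s hs).1, fun hs' => ?_⟩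
    rw [hs']
    exact MVStepCert.mem_bestEndBox hcj hx hz0 hz
  have hland : ∀ j < c.size, ∀ x ∈ boxSet (castBox (c.initAt j)), ∀ w,
      Q j (τ (j + 1) - τ j) x w → w ∈ boxSet (castBox (c.initAt (j + 1))) := by
    intro j hj x _ w hw
    obtain ⟨-, hw⟩ := hw
    exact boxSet_mono (castBox_mono (le_of_boxLE (check_stage hc hj).2)) (hw (hτs j))
  refine ⟨?_, fun y hy0 hy => ?_⟩
  · have hstep : ∀ j < c.size, ∀ x ∈ boxSet (castBox (c.initAt j)), ∃ z : ℝ → Fin n → ℝ, z 0 = x ∧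
        (∀ s ∈ Icc 0 (τ (j + 1) - τ j),
          HasDerivWithinAt z (evalVec (fieldMv c.field) (z s)) (Icc 0 (τ (j + 1) - τ j)) s) ∧
        ∀ s ∈ Icc 0 (τ (j + 1) - τ j), Q j s x (z s) := by
      intro j hj x hx
      obtain ⟨z, hz0, hz⟩ := MVStepCert.exists_of_check (check_stage hc hj).1 hx
      refine ⟨z, hz0, ?_, ?_⟩
      · rw [hτs]; exact hz
      · exact hall j hj x hx z hz0 (by rw [hτs]; exact hz)
    obtain ⟨y, hy0, hy, -, -⟩ :=
      exists_solution_of_stepChain (f := evalVec (fieldMv c.field))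
        (W := fun j => boxSet (castBox (c.initAt j))) (Q := Q) c.size hτ0 hτ hstep hland hy₀
    exact ⟨y, hy0, hy⟩
  · have hyW : y 0 ∈ boxSet (castBox (c.initAt 0)) := hy0 ▸ hy₀
    obtain ⟨hW, hQ'⟩ :=
      solution_mem_of_stepChain (f := evalVec (fieldMv c.field))
        (W := fun j => boxSet (castBox (c.initAt j))) (Q := Q) c.size hτ0 hτ hall hland hyW hy
    refine ⟨hW, fun j hj => ?_, fun j hj t ht => ?_⟩
    · have hmem : τ (j + 1) ∈ Icc (τ j) (τ (j + 1)) := ⟨hτ j hj, le_rfl⟩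
      obtain ⟨-, h2⟩ := hQ' j hj _ hmem
      exact h2 (hτs j)
    · obtain ⟨h1, -⟩ := hQ' j hj t ht
      exact h1

/-- **The certified final box**: every solution from `y₀ ∈ W₀` on `[0, τ_N]` has `y(τ_N) ∈ W_N`.
[cite: Moore1979, §8.1 eq. (8.13)] [cite: MrozekZgliczynski2000, §7.5 Lemma 7.6] -/
theorem mem_final (hc : c.check = true) {y₀ : Fin n → ℝ} (hy₀ : y₀ ∈ boxSet (castBox (c.initAt 0)))
    {y : ℝ → Fin n → ℝ} (hy0 : y 0 = y₀)
    (hy : ∀ t ∈ Icc 0 (c.toHOEChain.mesh c.size),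
      HasDerivWithinAt y (evalVec (fieldMv c.field) (y t)) (Icc 0 (c.toHOEChain.mesh c.size)) t) :
    y (c.toHOEChain.mesh c.size) ∈ boxSet (castBox c.final) := by
  have h := ((sound hc hy₀).2 y hy0 hy).1 c.size le_rfl
  rwa [initAt, stageAt_size] at h

end MVChainCert

end Chain

/-! ### The mean value chain certificate as a second `Verifier` for chain instances -/

section VerifierPackaging

variable {n : ℕ}

/-- The mean value chain certificate assembled from a chain instance (field, `W₀`, horizon,
final box — the instance type of `hoeChainVerifier`) and a list of mean value stages.
[cite: NedialkovJacksonCorliss1999, §5 Algorithm I] [cite: MrozekZgliczynski2000, §7.5 Lemma 7.6] -/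
def HOEChainInstance.withMVStages (I : HOEChainInstance n) (l : List (MVStage n)) :
    MVChainCert n :=
  ⟨I.field, l, I.final⟩

/-- **The mean-value-form chain certificate as a `Verifier`** for the SAME instances and claims as
`hoeChainVerifier` (existence on `[0, T]` from every `y₀ ∈ W₀` and `y(T) ∈ F` for every
solution): accept iff `W₀ ⊆` the first stage's box, the steps sum to the horizon, and the mean
value chain check passes; soundness = `MVChainCert.sound` / `mem_final`.
[cite: Moore1979, §8.1 eq. (8.13)] [cite: Moore1979, §4.3 eq. (4.19)]
[cite: MrozekZgliczynski2000, §7.5 Lemma 7.6] -/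
def mvChainVerifier (n : ℕ) : Verifier (HOEChainInstance n) HOEChainInstance.Claim where
  Cert := List (MVStage n)
  check I l :=
    boxLE I.init ((I.withMVStages l).initAt 0) &&
      decide ((I.withMVStages l).toHOEChain.meshQ l.length = I.horizon) &&
        (I.withMVStages l).check
  sound I l h := by
    simp only [Bool.and_eq_true, decide_eq_true_eq] at h
    obtain ⟨⟨h0, hT⟩, hc⟩ := h
    have hT' : (I.horizon : ℝ) =
        (I.withMVStages l).toHOEChain.mesh (I.withMVStages l).size := by
      rw [← hT, HOEChainCert.cast_meshQ]; rfl
    intro y₀ hy₀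
    have hy₀' : y₀ ∈ boxSet (castBox ((I.withMVStages l).initAt 0)) :=
      boxSet_mono (castBox_mono (le_of_boxLE h0)) hy₀
    refine ⟨?_, fun y hy0 hy => ?_⟩
    · obtain ⟨y, hy0, hy⟩ := (MVChainCert.sound hc hy₀').1
      exact ⟨y, hy0, by rw [hT']; exact hy⟩
    · rw [hT'] at hy ⊢
      exact MVChainCert.mem_final hc hy₀' hy0 hy

end VerifierPackaging

/-! ### Moore's Volterra example: four mean value steps, replayed by the kernel -/

section MooreExampleMVChain

/-- **The transcript**: Moore's problem (8.6) (`volterraField`: `x₁' = 2x₁(1 − x₂)`,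
`x₂' = −x₂(1 − x₁)`), `x(0) = (1, 3)`, four mean value steps of `h = 1/8` at order `6` with
centres the midpoints of the hand-over boxes; a-priori boxes `Sⱼ`, `VVⱼ`, `S_{mⱼ}` and the
hand-over boxes (`bestEndBoxⱼ` rounded outward to `10⁻⁷`) from an untrusted exact-rational search.
[cite: Moore1979, §8.1 eqs. (8.6)–(8.8), (8.13)] [cite: Moore1979, §4.3 eq. (4.19)] -/
def mooreVolterraMVStages : List (MVStage 2) :=
  [
    ⟨6, 1 / 8, ![pure 1, pure 3],
      ![⟨(4650 / 10000, 11459 / 10000), by decide +kernel⟩,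
        ⟨(29012 / 10000, 30204 / 10000), by decide +kernel⟩],
      ![![⟨(4107 / 10000, 11759 / 10000), by decide +kernel⟩, ⟨(-3284 / 10000, 1794 / 10000), by decide +kernel⟩],
        ![⟨(-1565 / 10000, 4407 / 10000), by decide +kernel⟩, ⟨(8990 / 10000, 10419 / 10000), by decide +kernel⟩]],
      ![1, 3], 6,
      ![⟨(4650 / 10000, 11459 / 10000), by decide +kernel⟩,
        ⟨(29012 / 10000, 30204 / 10000), by decide +kernel⟩]⟩,
    ⟨6, 1 / 8, ![⟨(6057131 / 10000000, 6158430 / 10000000), by decide +kernel⟩,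
        ⟨(29193295 / 10000000, 29237555 / 10000000), by decide +kernel⟩],
      ![⟨(2877 / 10000, 7060 / 10000), by decide +kernel⟩,
        ⟨(27199 / 10000, 29389 / 10000), by decide +kernel⟩],
      ![![⟨(4984 / 10000, 11185 / 10000), by decide +kernel⟩, ⟨(-1846 / 10000, 916 / 10000), by decide +kernel⟩],
        ![⟨(-1172 / 10000, 3890 / 10000), by decide +kernel⟩, ⟨(8926 / 10000, 10254 / 10000), by decide +kernel⟩]],
      ![12215561 / 20000000, 58430850 / 20000000], 6,
      ![⟨(2994 / 10000, 6974 / 10000), by decide +kernel⟩,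
        ⟨(27257 / 10000, 29362 / 10000), by decide +kernel⟩]⟩,
    ⟨6, 1 / 8, ![⟨(3811971 / 10000000, 3906408 / 10000000), by decide +kernel⟩,
        ⟨(27363708 / 10000000, 27444011 / 10000000), by decide +kernel⟩],
      ![⟨(1959 / 10000, 4437 / 10000), by decide +kernel⟩,
        ⟨(24984 / 10000, 27548 / 10000), by decide +kernel⟩],
      ![![⟨(5388 / 10000, 11168 / 10000), by decide +kernel⟩, ⟨(-1211 / 10000, 593 / 10000), by decide +kernel⟩],
        ![⟨(-1127 / 10000, 3685 / 10000), by decide +kernel⟩, ⟨(8862 / 10000, 10197 / 10000), by decide +kernel⟩]],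
      ![7718379 / 20000000, 54807719 / 20000000], 6,
      ![⟨(2065 / 10000, 4362 / 10000), by decide +kernel⟩,
        ⟨(25057 / 10000, 27504 / 10000), by decide +kernel⟩]⟩,
    ⟨6, 1 / 8, ![⟨(2530287 / 10000000, 2604932 / 10000000), by decide +kernel⟩,
        ⟨(25106406 / 10000000, 25206779 / 10000000), by decide +kernel⟩],
      ![⟨(1449 / 10000, 2905 / 10000), by decide +kernel⟩,
        ⟨(22666 / 10000, 25274 / 10000), by decide +kernel⟩],
      ![![⟨(5950 / 10000, 11040 / 10000), by decide +kernel⟩, ⟨(-831 / 10000, 397 / 10000), by decide +kernel⟩],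
        ![⟨(-1010 / 10000, 3400 / 10000), by decide +kernel⟩, ⟨(8832 / 10000, 10157 / 10000), by decide +kernel⟩]],
      ![5135219 / 20000000, 50313185 / 20000000], 6,
      ![⟨(1529 / 10000, 2849 / 10000), by decide +kernel⟩,
        ⟨(22743 / 10000, 25221 / 10000), by decide +kernel⟩]⟩]

/-- The chain instance: Volterra (8.6) from the point box `{(1, 3)}`, horizon `1/2`, claimed
final box `[0.1780709, 0.1839666] × [2.275256, 2.2861761]`.
[cite: Moore1979, §8.1 eqs. (8.6), (8.13)] -/
def mooreVolterraMVInstance : HOEChainInstance 2 :=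
  ⟨volterraField, ![pure 1, pure 3], 1 / 2,
    ![⟨(1780709 / 10000000, 1839666 / 10000000), by decide +kernel⟩,
        ⟨(22752560 / 10000000, 22861761 / 10000000), by decide +kernel⟩]⟩

/-- The mean value chain certificate of the transcript (= the verifier's internal certificate).
[cite: Moore1979, §8.1 eq. (8.13)] [cite: MrozekZgliczynski2000, §7.5 Lemma 7.6] -/
def mooreVolterraMVChain : MVChainCert 2 :=
  mooreVolterraMVInstance.withMVStages mooreVolterraMVStages

/-- **The kernel accepts the four-step mean value transcript.** [cite: Moore1979, §8.1 eq. (8.13)]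
[cite: Moore1979, §4.3 eq. (4.19)] -/
theorem mooreVolterraMVChain_check : mooreVolterraMVChain.check = true := by
  decide +kernel

/-- The transcript has four steps. [cite: Moore1979, §8.1 eq. (8.13)] -/
theorem mooreVolterraMVChain_size : mooreVolterraMVChain.size = 4 := rfl

/-- Its horizon is `τ₄ = 1/2`, in exact rational arithmetic. [cite: Moore1979, §8.1 eq. (8.13)]
[cite: Moore1966, §4.4] -/
theorem mooreVolterraMVChain_meshQ : mooreVolterraMVChain.toHOEChain.meshQ 4 = 1 / 2 := by
  simp only [HOEChainCert.meshQ, Finset.sum_range_succ, Finset.sum_range_zero,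
    MVChainCert.toHOEChain_step, MVChainCert.stageAt, mooreVolterraMVChain,
    mooreVolterraMVInstance, mooreVolterraMVStages, HOEChainInstance.withMVStages,
    List.getD_cons_zero, List.getD_cons_succ]
  norm_num

/-- Its horizon is `τ₄ = 1/2`. [cite: Moore1979, §8.1 eq. (8.13)] -/
theorem mooreVolterraMVChain_mesh : mooreVolterraMVChain.toHOEChain.mesh 4 = 1 / 2 := by
  rw [← HOEChainCert.cast_meshQ, mooreVolterraMVChain_meshQ]
  norm_num

/-- Moore's initial value `(1, 3)` lies in (is) `W₀`. [cite: Moore1979, §8.1 eq. (8.6)] -/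
theorem mooreVolterraMVChain_init_mem :
    (![1, 3] : Fin 2 → ℝ) ∈ boxSet (castBox (mooreVolterraMVChain.initAt 0)) := by
  rw [mem_boxSet_iff]
  intro i
  fin_cases i <;>
    simp [mooreVolterraMVChain, mooreVolterraMVInstance, mooreVolterraMVStages,
      HOEChainInstance.withMVStages, MVChainCert.initAt, MVChainCert.stageAt, castBox,
      mem_ratCast_iff]

/-- **Enclosure at `t = 1/2`** (kernel-certified): every solution of (8.6) from `(1, 3)` on
`[0, 0.5]` has `x(0.5) ∈ [0.1780709, 0.1839666] × [2.275256, 2.2861761]` (widths `0.0059`,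
`0.0109`); existence on `[0, 0.5]` is `mooreVolterraChain_exists` of
`HighOrderChainCertificate.lean` (or `mooreVolterraMVChain_claim` below).
[cite: Moore1979, §8.1 eqs. (8.6), (8.13)] [cite: Moore1979, §4.3 eq. (4.19)]
[cite: MrozekZgliczynski2000, §7.5 Lemma 7.6] -/
theorem mooreVolterraMVChain_final {z : ℝ → Fin 2 → ℝ} (hz0 : z 0 = ![1, 3])
    (hz : ∀ t ∈ Icc (0 : ℝ) (1 / 2),
      HasDerivWithinAt z (evalVec (fieldMv volterraField) (z t)) (Icc (0 : ℝ) (1 / 2)) t) :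
    z (1 / 2) ∈ boxSet (castBox mooreVolterraMVChain.final) := by
  have h := fun hz' =>
    MVChainCert.mem_final mooreVolterraMVChain_check mooreVolterraMVChain_init_mem hz0 hz'
  rw [mooreVolterraMVChain_size, mooreVolterraMVChain_mesh] at h
  exact h hz

/-- **Mean value chain versus direct chain** (the wrapping effect, kernel-checked): the final box
of the mean value transcript is contained in the final box
`[0.0589367, 0.3025851] × [2.23366, 2.327983]` certified by the direct-method transcript
`mooreVolterraChain` of `HighOrderChainCertificate.lean` for the same problem, mesh and order —
widths `0.0059 × 0.0109` against `0.24 × 0.094` (so `mooreVolterraChain_final` also follows from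
`mooreVolterraMVChain_final`). [cite: Moore1979, §8.2 (the wrapping effect)]
[cite: Moore1979, §4.3 eq. (4.19)] [cite: MrozekZgliczynski2000, §8 (p. 249)] -/
theorem mooreVolterraMVChain_final_le_direct :
    boxLE mooreVolterraMVChain.final mooreVolterraChain.final = true := by
  decide +kernel

/-- **The verifier's claim for the instance** (existence on `[0, 1/2]` from every point of `W₀`
and `y(1/2) ∈ F` for every solution), extracted from `mvChainVerifier` with the transcript as
certificate; the verifier's own landing and horizon tests are discharged by `decide` and
`mooreVolterraMVChain_meshQ`, the chain check is `mooreVolterraMVChain_check`.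
[cite: Moore1979, §8.1 eq. (8.13)] [cite: MrozekZgliczynski2000, §7.5 Lemma 7.6] -/
theorem mooreVolterraMVChain_claim : mooreVolterraMVInstance.Claim := by
  refine (mvChainVerifier 2).sound (c := mooreVolterraMVStages) ?_
  show (boxLE mooreVolterraMVInstance.init (mooreVolterraMVChain.initAt 0) &&
      decide (mooreVolterraMVChain.toHOEChain.meshQ mooreVolterraMVStages.length =
        mooreVolterraMVInstance.horizon) && mooreVolterraMVChain.check) = true
  rw [mooreVolterraMVChain_check, Bool.and_true, Bool.and_eq_true]
  exact ⟨by decide +kernel, decide_eq_true mooreVolterraMVChain_meshQ⟩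

end MooreExampleMVChain

end Literature.Analysis.ODE
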